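import Summits.QuantumFields.GaugeBoot.LoopEquationManyWords
import Summits.QuantumFields.GaugeBoot.StrongCouplingDoublePlaquette
import HarnessLib

/-!
# Strong coupling from the loop equation: the plaquette with TWO spectators and with the doubly-wound spectator (gauge-boot, ADDENDUM 25 part B)

HONEST FRAMING (cell `pub-gaugeboot`, page 1 of every file): the venture produces certified bounds
on lattice expectations at stated coupling, gauge group, dimension and torus size; NOT a mass gap,
NOT a continuum limit, NOT a string tension; NOT Yang–Mills-summit-bearing (barriers
`FixedCouplingUltralocality`, `PerturbativeInvisibility`).  Exact identities and crude explicit bounds on a finite torus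
`(ℤ/L)^d`, `L ≥ 2`, every real `β`; no number of the cell's tables is certified here.

## Content

ADDENDUM 24 reached the cubic moments of the `SU(3)` plaquette through the doubly-wound plaquette with ONE spectator and
the `SU(3)` Cayley–Hamilton identities.  For general `N` Cayley–Hamilton is not available; the missing rows are the
THREE-WORD loop equations of `LoopEquationManyWords` (two spectators both reading the marked link) and the two-word
equation with the DOUBLY-WOUND plaquette as spectator.  With `P̃₀ = plaqWord μ ν₀ true` marked at `e = (x, μ)`,
`t = tr hol P̃₀`, `t' = tr hol P̃₀⁻¹`, `D = tr hol(P̃₀P̃₀)` (weight `s`: `1` for `SU(N)`, `0` for `U(N)`):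

* `sum_mergeTerm_spectator_double` — pointwise merge sum of ANY marked word with the spectator `P̃₀P̃₀` (it joins
  twice, at its letters `0` and `4`): `2·(tr(ρ(hol w)ρ(hol P̃₀P̃₀)) − (s/N)·tr hol w·D)`;
* `norm_sum_sum_integral_plaqTerm_mul_mul_le` — the right sides with two spectator traces are bounded by
  `(d−1)·2·2N³(1+‖s‖)`;
* ★★ `twoSpectators_self_identity` — **`(N − 3s/N)·E[t³] + 2·E[D·t] = −(β/2)ΣΣ E[plaqTerm(P̃₀)·t²]`**;
* ★★ `doubleSpectator_identity` — **`(N − 3s/N)·E[D·t] + 2·E[tr(hol(P̃₀P̃₀)·hol P̃₀)] = −(β/2)ΣΣ E[plaqTerm(P̃₀)·D]`**;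
* ★★ `twoSpectators_reverse_identity` — **`(N + s/N)·E[t·t'·t'] − 2N·E[t'] = −(β/2)ΣΣ E[plaqTerm(P̃₀)·t'²]`**.
Together with ADDENDUM 24's `(N − 3s/N)·E[D·t] + E[t³] + E[tr(hol(P̃₀P̃₀)·hol P̃₀)] = O(β)` these rows form a linear
system for the cubic moments whose determinant `c(c² − 4)`, `c = N − 3s/N`, vanishes exactly for `SU(3)` (the baryon
vertex) and `U(2)`: for `SU(N ≥ 4)` all cubic plaquette moments are `O(β)` (`StrongCouplingCubicSUN`) and the second
strong-coupling coefficient of the plaquette vanishes (`StrongCouplingPlaquetteSUNThird`).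

References: Yu. Makeenko, *Methods of contemporary gauge theory* (2002) Problem 12.7; V. Kazakov, Z. Zheng,
arXiv:2404.16925 §2.3; M. Creutz, *Quarks, gluons and lattices* (1983) Ch. 8.  Everything is `[folklore]`.
-/

noncomputable section

open MeasureTheory Filter Topology NormedSpace
open scoped Matrix.Norms.Frobenius Matrix
open Literature.MathematicalPhysics.QuantumFieldTheory
open Summit.QuantumFields.YangMills.Cruxes.CurvatureAmnesia.WardDefect.SchwingerDyson

namespace Summit.QuantumFields.GaugeBoot

namespace StrongCoupling

variable {d L N : ℕ} {G : Type} [Group G] {ρ : G →* Matrix (Fin N) (Fin N) ℂ}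

/-! ## Pointwise: the doubly-wound plaquette as a spectator -/

section Pointwise

variable (ρ) in
/-- ★ **Merge sum, spectator = the doubly-wound plaquette `P̃₀P̃₀`, any marked word `w`** at `(x, μ)` (`L ≥ 2`): the
spectator traverses the edge forward at its letters `0` and `4`, each joining into the same loop, so
`Σ_{k'} mergeTerm_{k'}(w, P̃₀P̃₀) = 2·(tr(ρ(hol w)·ρ(hol P̃₀P̃₀)) − (s/N)·tr ρ(hol w)·tr ρ(hol P̃₀P̃₀))`. [folklore] -/
theorem sum_mergeTerm_spectator_double (hL : (1 : ZMod L) ≠ 0) (s : ℂ) (x : Site d L) {μ ν₀ : Fin d} (hμν₀ : μ ≠ ν₀)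
    (U : GaugeConfig d L G) (w : Word d) :
    ∑ k ∈ Finset.range (plaqWord μ ν₀ true ++ plaqWord μ ν₀ true).length,
        mergeTerm ρ s x μ U w x (plaqWord μ ν₀ true ++ plaqWord μ ν₀ true) k =
      2 * ((ρ (wordHolonomy U x w) * ρ (wordHolonomy U x (plaqWord μ ν₀ true ++ plaqWord μ ν₀ true))).trace -
        s / N * ((ρ (wordHolonomy U x w)).trace *
          (ρ (wordHolonomy U x (plaqWord μ ν₀ true ++ plaqWord μ ν₀ true))).trace)) := by
  rw [plaqWord_true_append_self]
  set W : Word d := [.fwd μ, .fwd ν₀, .bwd μ, .bwd ν₀, .fwd μ, .fwd ν₀, .bwd μ, .bwd ν₀] with hW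
  have hP : plaqWord μ ν₀ true = [.fwd μ, .fwd ν₀, .bwd μ, .bwd ν₀] := rfl
  have hlen : W.length = 8 := by rw [hW]; rfl
  rw [hlen]
  simp only [Finset.sum_range_succ, Finset.sum_range_zero, zero_add]
  have hνμ : ν₀ ≠ μ := fun h => hμν₀ h.symm
  have hWW : wordHolonomy U x W = wordHolonomy U x (plaqWord μ ν₀ true) * wordHolonomy U x (plaqWord μ ν₀ true) := by
    rw [show W = plaqWord μ ν₀ true ++ plaqWord μ ν₀ true by rw [hW, hP]; rfl,
      wordHolonomy_append_closed U x _ _ (endpoint_plaqWord x μ ν₀ true)]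
  have h0 : mergeTerm ρ s x μ U w x W 0 = (ρ (wordHolonomy U x w) * ρ (wordHolonomy U x W)).trace -
      s / N * ((ρ (wordHolonomy U x w)).trace * (ρ (wordHolonomy U x W)).trace) := by
    unfold mergeTerm
    rw [show W[0]? = some (.fwd μ) by rw [hW]; rfl]
    simp only [Word.siteAt_zero, Step.edge_fwd, if_true, Step.isFwd_fwd, List.drop_zero, List.take_zero, wordHolonomy_nil,
      map_one, mul_one]
  have h1 : mergeTerm ρ s x μ U w x W 1 = 0 :=
    mergeTerm_eq_zero_of_edge_ne s x μ U _ x (v := W) (k := 1) (st := .fwd ν₀) (by rw [hW]; rfl) (Step.edge_ne_of_axis_ne hνμ)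
  have h3 : mergeTerm ρ s x μ U w x W 3 = 0 :=
    mergeTerm_eq_zero_of_edge_ne s x μ U _ x (v := W) (k := 3) (st := .bwd ν₀) (by rw [hW]; rfl) (Step.edge_ne_of_axis_ne hνμ)
  have h5 : mergeTerm ρ s x μ U w x W 5 = 0 :=
    mergeTerm_eq_zero_of_edge_ne s x μ U _ x (v := W) (k := 5) (st := .fwd ν₀) (by rw [hW]; rfl) (Step.edge_ne_of_axis_ne hνμ)
  have h7 : mergeTerm ρ s x μ U w x W 7 = 0 :=
    mergeTerm_eq_zero_of_edge_ne s x μ U _ x (v := W) (k := 7) (st := .bwd ν₀) (by rw [hW]; rfl) (Step.edge_ne_of_axis_ne hνμ)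
  have h2 : mergeTerm ρ s x μ U w x W 2 = 0 :=
    mergeTerm_eq_zero_of_edge_ne s x μ U _ x (v := W) (k := 2) (st := .bwd μ) (by rw [hW]; rfl)
      (Step.bwd_edge_ne (site_ne_of_apply_ne ν₀ (by
        simp only [hW, Word.siteAt, List.take_succ_cons, List.take_zero, Word.endpoint_cons, Word.endpoint_nil,
          Step.apply_fwd, Site.shift, Pi.add_apply, Pi.sub_apply, Pi.single_eq_same, Pi.single_eq_of_ne hνμ]
        exact zmod_ne_of_sub_eq_one hL (by ring))))
  have h6 : mergeTerm ρ s x μ U w x W 6 = 0 :=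
    mergeTerm_eq_zero_of_edge_ne s x μ U _ x (v := W) (k := 6) (st := .bwd μ) (by rw [hW]; rfl)
      (Step.bwd_edge_ne (site_ne_of_apply_ne ν₀ (by
        simp only [hW, Word.siteAt, List.take_succ_cons, List.take_zero, Word.endpoint_cons, Word.endpoint_nil,
          Step.apply_fwd, Step.apply_bwd, Site.shift, Pi.add_apply, Pi.sub_apply, Pi.single_eq_same,
          Pi.single_eq_of_ne hνμ]
        exact zmod_ne_of_sub_eq_one hL (by ring))))
  have h4 : mergeTerm ρ s x μ U w x W 4 = (ρ (wordHolonomy U x w) * ρ (wordHolonomy U x W)).trace -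
      s / N * ((ρ (wordHolonomy U x w)).trace * (ρ (wordHolonomy U x W)).trace) := by
    have hs4 : Word.siteAt x W 4 = x := by rw [hW]; exact siteAt_double_four x μ ν₀
    unfold mergeTerm
    rw [show W[4]? = some (.fwd μ) by rw [hW]; rfl]
    simp only [hs4, Step.edge_fwd, if_true, Step.isFwd_fwd]
    rw [show W.take 4 = plaqWord μ ν₀ true by rw [hW, hP]; rfl, show W.drop 4 = plaqWord μ ν₀ true by rw [hW, hP]; rfl,
      ← map_mul, ← hWW]
  rw [h0, h1, h2, h3, h4, h5, h6, h7]
  ring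

/-- `ρ(hol P̃₀)·ρ(hol P̃₀) = ρ(hol(P̃₀P̃₀))`. [folklore] -/
theorem rho_mul_self_eq_double (U : GaugeConfig d L G) (x : Site d L) (μ ν₀ : Fin d) :
    ρ (wordHolonomy U x (plaqWord μ ν₀ true)) * ρ (wordHolonomy U x (plaqWord μ ν₀ true)) =
      ρ (wordHolonomy U x (plaqWord μ ν₀ true ++ plaqWord μ ν₀ true)) := by
  rw [← map_mul, wordHolonomy_append_closed U x _ _ (endpoint_plaqWord x μ ν₀ true)]

end Pointwise

/-! ## Integrated: three identities and the bound on their right sides -/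

section Integrated

variable [TopologicalSpace G] [IsTopologicalGroup G] [CompactSpace G] [MeasurableSpace G] [BorelSpace G]
  (r : LatticeRep G) [NeZero L]

omit [IsTopologicalGroup G] [CompactSpace G] [MeasurableSpace G] [BorelSpace G] [NeZero L] in
/-- **Pointwise bound** `‖plaqTerm · (tr ρ(hol v₁) · tr ρ(hol v₂))‖ ≤ 2N(1+‖s‖)·N·N`. [folklore] -/
theorem norm_plaqTerm_mul_mul_le (s : ℂ) (x : Site d L) (μ : Fin d) (U : GaugeConfig d L G) (w : Word d) (ν : Fin d)
    (ε : Bool) (x₁ : Site d L) (v₁ : Word d) (x₂ : Site d L) (v₂ : Word d) :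
    ‖plaqTerm r.ρ s x μ U w ν ε * ((r.ρ (wordHolonomy U x₁ v₁)).trace * (r.ρ (wordHolonomy U x₂ v₂)).trace)‖ ≤
      2 * r.N * (1 + ‖s‖) * r.N * r.N := by
  rw [norm_mul, norm_mul, ← mul_assoc]
  exact mul_le_mul (mul_le_mul (norm_plaqTerm_le r s x μ U w ν ε) (norm_trace_le r _) (norm_nonneg _) (by positivity))
    (norm_trace_le r _) (norm_nonneg _) (by positivity)

/-- **The right sides with two spectators are bounded**: `‖ΣΣ E[plaqTerm·tr hol v₁·tr hol v₂]‖ ≤ (d−1)·2·(2N(1+‖s‖)·N·N)`.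
[folklore] -/
theorem norm_sum_sum_integral_plaqTerm_mul_mul_le (β : ℝ) (s : ℂ) (x : Site d L) (μ : Fin d) (w : Word d)
    (x₁ : Site d L) (v₁ : Word d) (x₂ : Site d L) (v₂ : Word d) :
    ‖∑ ν ∈ Finset.univ.erase μ, ∑ ε : Bool, ∫ U, plaqTerm r.ρ s x μ U w ν ε *
        ((r.ρ (wordHolonomy U x₁ v₁)).trace * (r.ρ (wordHolonomy U x₂ v₂)).trace)
          ∂(wilsonMeasure (d := d) (L := L) r.ρ β)‖ ≤ ((d : ℝ) - 1) * (2 * (2 * r.N * (1 + ‖s‖) * r.N * r.N)) := by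
  haveI := isProbabilityMeasure_wilsonMeasure (d := d) (L := L) r.ρ r.continuous β
  have hterm : ∀ ν ε, ‖∫ U, plaqTerm r.ρ s x μ U w ν ε *
      ((r.ρ (wordHolonomy U x₁ v₁)).trace * (r.ρ (wordHolonomy U x₂ v₂)).trace)
        ∂(wilsonMeasure (d := d) (L := L) r.ρ β)‖ ≤ 2 * r.N * (1 + ‖s‖) * r.N * r.N := fun ν ε => by
    have h := norm_integral_le_of_norm_le_const (μ := wilsonMeasure (d := d) (L := L) r.ρ β)
      (ae_of_all _ fun U => norm_plaqTerm_mul_mul_le r s x μ U w ν ε x₁ v₁ x₂ v₂)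
    rwa [probReal_univ, mul_one] at h
  calc _ ≤ ∑ ν ∈ Finset.univ.erase μ, ‖∑ ε : Bool, ∫ U, plaqTerm r.ρ s x μ U w ν ε *
          ((r.ρ (wordHolonomy U x₁ v₁)).trace * (r.ρ (wordHolonomy U x₂ v₂)).trace)
            ∂(wilsonMeasure (d := d) (L := L) r.ρ β)‖ := norm_sum_le _ _
    _ ≤ ∑ ν ∈ Finset.univ.erase μ, (2 * (2 * r.N * (1 + ‖s‖) * r.N * r.N)) := by
        refine Finset.sum_le_sum fun ν _ => (norm_sum_le _ _).trans ?_
        calc _ ≤ ∑ _ε : Bool, 2 * r.N * (1 + ‖s‖) * r.N * r.N := Finset.sum_le_sum fun ε _ => hterm ν ε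
          _ = 2 * (2 * r.N * (1 + ‖s‖) * r.N * r.N) := by simp [two_mul]
    _ = ((d : ℝ) - 1) * (2 * (2 * r.N * (1 + ‖s‖) * r.N * r.N)) := by
        rw [Finset.sum_const, nsmul_eq_mul, card_univ_erase_real]

/-- ★★ **The plaquette with itself twice as spectator.**  With `t = tr hol P̃₀`, `D = tr hol(P̃₀P̃₀)` (Wilson's measure at
`β`): `(N − 3s/N)·E[t·t·t] + 2·E[D·t] = −(β/2)·ΣΣ E[plaqTerm_{ν,ε}(P̃₀)·(t·t)]` — the three-word loop equation of
`P̃₀` with spectators `P̃₀, P̃₀` (each joins once). [folklore] -/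
theorem twoSpectators_self_identity (hL : (1 : ZMod L) ≠ 0) (β : ℝ) (x : Site d L) {μ ν₀ : Fin d} (hμν₀ : μ ≠ ν₀)
    (s : ℂ) (hP : ∀ i j : Fin r.N, SDPairMany r β x μ x (plaqWord μ ν₀ true) ![x, x]
      ![plaqWord μ ν₀ true, plaqWord μ ν₀ true] (fun _ => (1 : ℂ)) (unitDir s i j)) :
    ((r.N : ℂ) - 3 * s / r.N) * (∫ U, (r.ρ (wordHolonomy U x (plaqWord μ ν₀ true))).trace *
        (r.ρ (wordHolonomy U x (plaqWord μ ν₀ true))).trace * (r.ρ (wordHolonomy U x (plaqWord μ ν₀ true))).trace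
          ∂(wilsonMeasure (d := d) (L := L) r.ρ β)) +
      2 * (∫ U, (r.ρ (wordHolonomy U x (plaqWord μ ν₀ true ++ plaqWord μ ν₀ true))).trace *
        (r.ρ (wordHolonomy U x (plaqWord μ ν₀ true))).trace ∂(wilsonMeasure (d := d) (L := L) r.ρ β)) =
      -((β / 2 : ℂ) * ∑ ν ∈ Finset.univ.erase μ, ∑ ε : Bool,
        ∫ U, plaqTerm r.ρ s x μ U (plaqWord μ ν₀ true) ν ε * ((r.ρ (wordHolonomy U x (plaqWord μ ν₀ true))).trace *
          (r.ρ (wordHolonomy U x (plaqWord μ ν₀ true))).trace) ∂(wilsonMeasure (d := d) (L := L) r.ρ β)) := by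
  have h := loopEquation₃_of_sdPairMany r β x μ s (plaqWord μ ν₀ true) (endpoint_plaqWord x μ ν₀ true) x
    (plaqWord μ ν₀ true) x (plaqWord μ ν₀ true) hP
  rw [← integral_finsetSum _ fun k _ => integrable_of_continuous r β
      (F := fun U => splitTerm r.ρ s x μ U (plaqWord μ ν₀ true) k * ((r.ρ (wordHolonomy U x (plaqWord μ ν₀ true))).trace *
        (r.ρ (wordHolonomy U x (plaqWord μ ν₀ true))).trace))
      ((continuous_splitTerm r s x μ _ k).mul ((continuous_trace_wordHolonomy r x _).mul (continuous_trace_wordHolonomy r x _))),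
    ← integral_finsetSum _ fun k _ => integrable_of_continuous r β
      (F := fun U => (r.ρ (wordHolonomy U x (plaqWord μ ν₀ true))).trace * mergeTerm r.ρ s x μ U (plaqWord μ ν₀ true) x
        (plaqWord μ ν₀ true) k)
      ((continuous_trace_wordHolonomy r x _).mul (continuous_mergeTerm r s x μ _ x _ k))] at h
  simp_rw [← Finset.sum_mul, ← Finset.mul_sum, Equipartition.sum_splitTerm_plaqWord r.ρ hL s x hμν₀ _ true,
    sum_mergeTerm_self r.ρ hL s x hμν₀] at h
  have hc : ∀ u : Word d, Continuous fun U : GaugeConfig d L G => (r.ρ (wordHolonomy U x u)).trace :=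
    fun u => continuous_trace_wordHolonomy r x u
  have hiK : Integrable (fun U : GaugeConfig d L G => (r.ρ (wordHolonomy U x (plaqWord μ ν₀ true))).trace *
      (r.ρ (wordHolonomy U x (plaqWord μ ν₀ true))).trace * (r.ρ (wordHolonomy U x (plaqWord μ ν₀ true))).trace)
      (wilsonMeasure (d := d) (L := L) r.ρ β) := integrable_of_continuous r β (((hc _).mul (hc _)).mul (hc _))
  have hiY : Integrable (fun U : GaugeConfig d L G => (r.ρ (wordHolonomy U x (plaqWord μ ν₀ true ++ plaqWord μ ν₀ true))).trace *
      (r.ρ (wordHolonomy U x (plaqWord μ ν₀ true))).trace) (wilsonMeasure (d := d) (L := L) r.ρ β) :=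
    integrable_of_continuous r β ((hc _).mul (hc _))
  have e1 : ∀ U : GaugeConfig d L G, ((r.N : ℂ) - s / r.N) * (r.ρ (wordHolonomy U x (plaqWord μ ν₀ true))).trace *
      ((r.ρ (wordHolonomy U x (plaqWord μ ν₀ true))).trace * (r.ρ (wordHolonomy U x (plaqWord μ ν₀ true))).trace) +
      (r.ρ (wordHolonomy U x (plaqWord μ ν₀ true))).trace *
        ((r.ρ (wordHolonomy U x (plaqWord μ ν₀ true ++ plaqWord μ ν₀ true))).trace -
          s / r.N * ((r.ρ (wordHolonomy U x (plaqWord μ ν₀ true))).trace * (r.ρ (wordHolonomy U x (plaqWord μ ν₀ true))).trace)) +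
      (r.ρ (wordHolonomy U x (plaqWord μ ν₀ true))).trace *
        ((r.ρ (wordHolonomy U x (plaqWord μ ν₀ true ++ plaqWord μ ν₀ true))).trace -
          s / r.N * ((r.ρ (wordHolonomy U x (plaqWord μ ν₀ true))).trace * (r.ρ (wordHolonomy U x (plaqWord μ ν₀ true))).trace)) =
      ((r.N : ℂ) - 3 * s / r.N) * ((r.ρ (wordHolonomy U x (plaqWord μ ν₀ true))).trace *
        (r.ρ (wordHolonomy U x (plaqWord μ ν₀ true))).trace * (r.ρ (wordHolonomy U x (plaqWord μ ν₀ true))).trace) +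
      2 * ((r.ρ (wordHolonomy U x (plaqWord μ ν₀ true ++ plaqWord μ ν₀ true))).trace *
        (r.ρ (wordHolonomy U x (plaqWord μ ν₀ true))).trace) := fun U => by ring
  have hsplit : ∫ U, (((r.N : ℂ) - s / r.N) * (r.ρ (wordHolonomy U x (plaqWord μ ν₀ true))).trace *
      ((r.ρ (wordHolonomy U x (plaqWord μ ν₀ true))).trace * (r.ρ (wordHolonomy U x (plaqWord μ ν₀ true))).trace) +
      (r.ρ (wordHolonomy U x (plaqWord μ ν₀ true))).trace *
        ((r.ρ (wordHolonomy U x (plaqWord μ ν₀ true ++ plaqWord μ ν₀ true))).trace -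
          s / r.N * ((r.ρ (wordHolonomy U x (plaqWord μ ν₀ true))).trace * (r.ρ (wordHolonomy U x (plaqWord μ ν₀ true))).trace)) +
      (r.ρ (wordHolonomy U x (plaqWord μ ν₀ true))).trace *
        ((r.ρ (wordHolonomy U x (plaqWord μ ν₀ true ++ plaqWord μ ν₀ true))).trace -
          s / r.N * ((r.ρ (wordHolonomy U x (plaqWord μ ν₀ true))).trace * (r.ρ (wordHolonomy U x (plaqWord μ ν₀ true))).trace)))
        ∂(wilsonMeasure (d := d) (L := L) r.ρ β) =
      ((r.N : ℂ) - 3 * s / r.N) * (∫ U, (r.ρ (wordHolonomy U x (plaqWord μ ν₀ true))).trace *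
        (r.ρ (wordHolonomy U x (plaqWord μ ν₀ true))).trace * (r.ρ (wordHolonomy U x (plaqWord μ ν₀ true))).trace
          ∂(wilsonMeasure (d := d) (L := L) r.ρ β)) +
      2 * (∫ U, (r.ρ (wordHolonomy U x (plaqWord μ ν₀ true ++ plaqWord μ ν₀ true))).trace *
        (r.ρ (wordHolonomy U x (plaqWord μ ν₀ true))).trace ∂(wilsonMeasure (d := d) (L := L) r.ρ β)) := by
    simp_rw [e1]
    rw [integral_add (hiK.const_mul _) (hiY.const_mul _), integral_const_mul, integral_const_mul]
  have hiA : Integrable (fun U : GaugeConfig d L G => ((r.N : ℂ) - s / r.N) * (r.ρ (wordHolonomy U x (plaqWord μ ν₀ true))).trace *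
      ((r.ρ (wordHolonomy U x (plaqWord μ ν₀ true))).trace * (r.ρ (wordHolonomy U x (plaqWord μ ν₀ true))).trace))
      (wilsonMeasure (d := d) (L := L) r.ρ β) := integrable_of_continuous r β ((continuous_const.mul (hc _)).mul ((hc _).mul (hc _)))
  have hiB : Integrable (fun U : GaugeConfig d L G => (r.ρ (wordHolonomy U x (plaqWord μ ν₀ true))).trace *
        ((r.ρ (wordHolonomy U x (plaqWord μ ν₀ true ++ plaqWord μ ν₀ true))).trace -
          s / r.N * ((r.ρ (wordHolonomy U x (plaqWord μ ν₀ true))).trace * (r.ρ (wordHolonomy U x (plaqWord μ ν₀ true))).trace)))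
      (wilsonMeasure (d := d) (L := L) r.ρ β) :=
    integrable_of_continuous r β ((hc _).mul ((hc _).sub (continuous_const.mul ((hc _).mul (hc _)))))
  have hiAB : Integrable (fun U : GaugeConfig d L G => ((r.N : ℂ) - s / r.N) * (r.ρ (wordHolonomy U x (plaqWord μ ν₀ true))).trace *
      ((r.ρ (wordHolonomy U x (plaqWord μ ν₀ true))).trace * (r.ρ (wordHolonomy U x (plaqWord μ ν₀ true))).trace) +
      (r.ρ (wordHolonomy U x (plaqWord μ ν₀ true))).trace *
        ((r.ρ (wordHolonomy U x (plaqWord μ ν₀ true ++ plaqWord μ ν₀ true))).trace -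
          s / r.N * ((r.ρ (wordHolonomy U x (plaqWord μ ν₀ true))).trace * (r.ρ (wordHolonomy U x (plaqWord μ ν₀ true))).trace)))
      (wilsonMeasure (d := d) (L := L) r.ρ β) := hiA.add hiB
  rw [← integral_add hiA hiB, ← integral_add hiAB hiB, hsplit] at h
  linear_combination h

/-- ★★ **The plaquette with the doubly-wound plaquette as spectator.**  With `t`, `D` as above and
`Z = E[tr(ρ(hol(P̃₀P̃₀))·ρ(hol P̃₀))]` (`= E[tr U_P³]`):
`(N − 3s/N)·E[D·t] + 2·Z = −(β/2)·ΣΣ E[plaqTerm_{ν,ε}(P̃₀)·D]` — the two-word loop equation of `P̃₀` with spectator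
`P̃₀P̃₀` (it joins twice). [folklore] -/
theorem doubleSpectator_identity (hL : (1 : ZMod L) ≠ 0) (β : ℝ) (x : Site d L) {μ ν₀ : Fin d} (hμν₀ : μ ≠ ν₀) (s : ℂ)
    (hP : ∀ i j : Fin r.N, SDPair₂ r β x μ x (plaqWord μ ν₀ true) x (plaqWord μ ν₀ true ++ plaqWord μ ν₀ true) (unitDir s i j)) :
    ((r.N : ℂ) - 3 * s / r.N) * (∫ U, (r.ρ (wordHolonomy U x (plaqWord μ ν₀ true ++ plaqWord μ ν₀ true))).trace *
        (r.ρ (wordHolonomy U x (plaqWord μ ν₀ true))).trace ∂(wilsonMeasure (d := d) (L := L) r.ρ β)) +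
      2 * (∫ U, (r.ρ (wordHolonomy U x (plaqWord μ ν₀ true ++ plaqWord μ ν₀ true)) *
        r.ρ (wordHolonomy U x (plaqWord μ ν₀ true))).trace ∂(wilsonMeasure (d := d) (L := L) r.ρ β)) =
      -((β / 2 : ℂ) * ∑ ν ∈ Finset.univ.erase μ, ∑ ε : Bool,
        ∫ U, plaqTerm r.ρ s x μ U (plaqWord μ ν₀ true) ν ε *
          (r.ρ (wordHolonomy U x (plaqWord μ ν₀ true ++ plaqWord μ ν₀ true))).trace ∂(wilsonMeasure (d := d) (L := L) r.ρ β)) := by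
  have h := loopEquation₂_of_sdPair₂ r β x μ s (plaqWord μ ν₀ true) (endpoint_plaqWord x μ ν₀ true) x
    (plaqWord μ ν₀ true ++ plaqWord μ ν₀ true) hP
  rw [← integral_finsetSum _ fun k _ => integrable_of_continuous r β
      (F := fun U => splitTerm r.ρ s x μ U (plaqWord μ ν₀ true) k *
        (r.ρ (wordHolonomy U x (plaqWord μ ν₀ true ++ plaqWord μ ν₀ true))).trace)
      ((continuous_splitTerm r s x μ _ k).mul (continuous_trace_wordHolonomy r x _)),
    ← integral_finsetSum _ fun k _ => integrable_of_continuous r β (continuous_mergeTerm r s x μ _ x _ k)] at h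
  simp_rw [← Finset.sum_mul, Equipartition.sum_splitTerm_plaqWord r.ρ hL s x hμν₀ _ true,
    sum_mergeTerm_spectator_double r.ρ hL s x hμν₀] at h
  have hc : ∀ u : Word d, Continuous fun U : GaugeConfig d L G => (r.ρ (wordHolonomy U x u)).trace :=
    fun u => continuous_trace_wordHolonomy r x u
  have hcomm : ∀ U : GaugeConfig d L G, (r.ρ (wordHolonomy U x (plaqWord μ ν₀ true)) *
      r.ρ (wordHolonomy U x (plaqWord μ ν₀ true ++ plaqWord μ ν₀ true))).trace =
      (r.ρ (wordHolonomy U x (plaqWord μ ν₀ true ++ plaqWord μ ν₀ true)) * r.ρ (wordHolonomy U x (plaqWord μ ν₀ true))).trace :=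
    fun U => Matrix.trace_mul_comm _ _
  have e1 : ∀ U : GaugeConfig d L G, ((r.N : ℂ) - s / r.N) * (r.ρ (wordHolonomy U x (plaqWord μ ν₀ true))).trace *
      (r.ρ (wordHolonomy U x (plaqWord μ ν₀ true ++ plaqWord μ ν₀ true))).trace +
      2 * ((r.ρ (wordHolonomy U x (plaqWord μ ν₀ true)) * r.ρ (wordHolonomy U x (plaqWord μ ν₀ true ++ plaqWord μ ν₀ true))).trace -
        s / r.N * ((r.ρ (wordHolonomy U x (plaqWord μ ν₀ true))).trace *
          (r.ρ (wordHolonomy U x (plaqWord μ ν₀ true ++ plaqWord μ ν₀ true))).trace)) =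
      ((r.N : ℂ) - 3 * s / r.N) * ((r.ρ (wordHolonomy U x (plaqWord μ ν₀ true ++ plaqWord μ ν₀ true))).trace *
        (r.ρ (wordHolonomy U x (plaqWord μ ν₀ true))).trace) +
      2 * (r.ρ (wordHolonomy U x (plaqWord μ ν₀ true ++ plaqWord μ ν₀ true)) *
        r.ρ (wordHolonomy U x (plaqWord μ ν₀ true))).trace := fun U => by rw [hcomm]; ring
  have hiY : Integrable (fun U : GaugeConfig d L G => (r.ρ (wordHolonomy U x (plaqWord μ ν₀ true ++ plaqWord μ ν₀ true))).trace *
      (r.ρ (wordHolonomy U x (plaqWord μ ν₀ true))).trace) (wilsonMeasure (d := d) (L := L) r.ρ β) :=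
    integrable_of_continuous r β ((hc _).mul (hc _))
  have hiZ : Integrable (fun U : GaugeConfig d L G => (r.ρ (wordHolonomy U x (plaqWord μ ν₀ true ++ plaqWord μ ν₀ true)) *
      r.ρ (wordHolonomy U x (plaqWord μ ν₀ true))).trace) (wilsonMeasure (d := d) (L := L) r.ρ β) :=
    integrable_of_continuous r β (((r.continuous.comp (continuous_wordHolonomy x _)).mul
      (r.continuous.comp (continuous_wordHolonomy x _))).matrix_trace)
  have hiA : Integrable (fun U : GaugeConfig d L G => ((r.N : ℂ) - s / r.N) * (r.ρ (wordHolonomy U x (plaqWord μ ν₀ true))).trace *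
      (r.ρ (wordHolonomy U x (plaqWord μ ν₀ true ++ plaqWord μ ν₀ true))).trace) (wilsonMeasure (d := d) (L := L) r.ρ β) :=
    integrable_of_continuous r β ((continuous_const.mul (hc _)).mul (hc _))
  have hiB : Integrable (fun U : GaugeConfig d L G =>
      2 * ((r.ρ (wordHolonomy U x (plaqWord μ ν₀ true)) * r.ρ (wordHolonomy U x (plaqWord μ ν₀ true ++ plaqWord μ ν₀ true))).trace -
        s / r.N * ((r.ρ (wordHolonomy U x (plaqWord μ ν₀ true))).trace *
          (r.ρ (wordHolonomy U x (plaqWord μ ν₀ true ++ plaqWord μ ν₀ true))).trace))) (wilsonMeasure (d := d) (L := L) r.ρ β) :=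
    integrable_of_continuous r β (continuous_const.mul ((((r.continuous.comp (continuous_wordHolonomy x _)).mul
      (r.continuous.comp (continuous_wordHolonomy x _))).matrix_trace).sub (continuous_const.mul ((hc _).mul (hc _)))))
  have hsplit : ∫ U, (((r.N : ℂ) - s / r.N) * (r.ρ (wordHolonomy U x (plaqWord μ ν₀ true))).trace *
      (r.ρ (wordHolonomy U x (plaqWord μ ν₀ true ++ plaqWord μ ν₀ true))).trace +
      2 * ((r.ρ (wordHolonomy U x (plaqWord μ ν₀ true)) * r.ρ (wordHolonomy U x (plaqWord μ ν₀ true ++ plaqWord μ ν₀ true))).trace -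
        s / r.N * ((r.ρ (wordHolonomy U x (plaqWord μ ν₀ true))).trace *
          (r.ρ (wordHolonomy U x (plaqWord μ ν₀ true ++ plaqWord μ ν₀ true))).trace))) ∂(wilsonMeasure (d := d) (L := L) r.ρ β) =
      ((r.N : ℂ) - 3 * s / r.N) * (∫ U, (r.ρ (wordHolonomy U x (plaqWord μ ν₀ true ++ plaqWord μ ν₀ true))).trace *
        (r.ρ (wordHolonomy U x (plaqWord μ ν₀ true))).trace ∂(wilsonMeasure (d := d) (L := L) r.ρ β)) +
      2 * (∫ U, (r.ρ (wordHolonomy U x (plaqWord μ ν₀ true ++ plaqWord μ ν₀ true)) *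
        r.ρ (wordHolonomy U x (plaqWord μ ν₀ true))).trace ∂(wilsonMeasure (d := d) (L := L) r.ρ β)) := by
    simp_rw [e1]
    rw [integral_add (hiY.const_mul _) (hiZ.const_mul _), integral_const_mul, integral_const_mul]
  rw [← integral_add hiA hiB, hsplit] at h
  linear_combination h

/-- ★★ **The plaquette with its reverse twice as spectator.**  With `t = tr hol P̃₀`, `t' = tr hol P̃₀⁻¹`:
`(N + s/N)·E[t·t'·t'] − 2N·E[t'] = −(β/2)·ΣΣ E[plaqTerm_{ν,ε}(P̃₀)·(t'·t')]` — each reverse spectator joins once, backward,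
into the trivial loop `P̃₀P̃₀⁻¹` (trace `N`), which is where the `O(1)`-looking term `2N·E[t']` comes from. [folklore] -/
theorem twoSpectators_reverse_identity (hL : (1 : ZMod L) ≠ 0) (β : ℝ) (x : Site d L) {μ ν₀ : Fin d} (hμν₀ : μ ≠ ν₀)
    (s : ℂ) (hP : ∀ i j : Fin r.N, SDPairMany r β x μ x (plaqWord μ ν₀ true) ![x, x]
      ![(plaqWord μ ν₀ true).reverse, (plaqWord μ ν₀ true).reverse] (fun _ => (1 : ℂ)) (unitDir s i j)) :
    ((r.N : ℂ) + s / r.N) * (∫ U, (r.ρ (wordHolonomy U x (plaqWord μ ν₀ true))).trace *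
        (r.ρ (wordHolonomy U x (plaqWord μ ν₀ true).reverse)).trace * (r.ρ (wordHolonomy U x (plaqWord μ ν₀ true).reverse)).trace
          ∂(wilsonMeasure (d := d) (L := L) r.ρ β)) -
      2 * r.N * (∫ U, (r.ρ (wordHolonomy U x (plaqWord μ ν₀ true).reverse)).trace ∂(wilsonMeasure (d := d) (L := L) r.ρ β)) =
      -((β / 2 : ℂ) * ∑ ν ∈ Finset.univ.erase μ, ∑ ε : Bool,
        ∫ U, plaqTerm r.ρ s x μ U (plaqWord μ ν₀ true) ν ε * ((r.ρ (wordHolonomy U x (plaqWord μ ν₀ true).reverse)).trace *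
          (r.ρ (wordHolonomy U x (plaqWord μ ν₀ true).reverse)).trace) ∂(wilsonMeasure (d := d) (L := L) r.ρ β)) := by
  have h := loopEquation₃_of_sdPairMany r β x μ s (plaqWord μ ν₀ true) (endpoint_plaqWord x μ ν₀ true) x
    (plaqWord μ ν₀ true).reverse x (plaqWord μ ν₀ true).reverse hP
  rw [← integral_finsetSum _ fun k _ => integrable_of_continuous r β
      (F := fun U => splitTerm r.ρ s x μ U (plaqWord μ ν₀ true) k * ((r.ρ (wordHolonomy U x (plaqWord μ ν₀ true).reverse)).trace *
        (r.ρ (wordHolonomy U x (plaqWord μ ν₀ true).reverse)).trace))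
      ((continuous_splitTerm r s x μ _ k).mul ((continuous_trace_wordHolonomy r x _).mul (continuous_trace_wordHolonomy r x _))),
    ← integral_finsetSum _ fun k _ => integrable_of_continuous r β
      (F := fun U => (r.ρ (wordHolonomy U x (plaqWord μ ν₀ true).reverse)).trace * mergeTerm r.ρ s x μ U (plaqWord μ ν₀ true) x
        (plaqWord μ ν₀ true).reverse k)
      ((continuous_trace_wordHolonomy r x _).mul (continuous_mergeTerm r s x μ _ x _ k))] at h
  simp_rw [← Finset.sum_mul, ← Finset.mul_sum, Equipartition.sum_splitTerm_plaqWord r.ρ hL s x hμν₀ _ true,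
    sum_mergeTerm_reverse r.ρ hL s x hμν₀] at h
  have hc : ∀ u : Word d, Continuous fun U : GaugeConfig d L G => (r.ρ (wordHolonomy U x u)).trace :=
    fun u => continuous_trace_wordHolonomy r x u
  have hiK : Integrable (fun U : GaugeConfig d L G => (r.ρ (wordHolonomy U x (plaqWord μ ν₀ true))).trace *
      (r.ρ (wordHolonomy U x (plaqWord μ ν₀ true).reverse)).trace * (r.ρ (wordHolonomy U x (plaqWord μ ν₀ true).reverse)).trace)
      (wilsonMeasure (d := d) (L := L) r.ρ β) := integrable_of_continuous r β (((hc _).mul (hc _)).mul (hc _))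
  have hiT : Integrable (fun U : GaugeConfig d L G => (r.ρ (wordHolonomy U x (plaqWord μ ν₀ true).reverse)).trace)
      (wilsonMeasure (d := d) (L := L) r.ρ β) := integrable_of_continuous r β (hc _)
  have e1 : ∀ U : GaugeConfig d L G, ((r.N : ℂ) - s / r.N) * (r.ρ (wordHolonomy U x (plaqWord μ ν₀ true))).trace *
      ((r.ρ (wordHolonomy U x (plaqWord μ ν₀ true).reverse)).trace * (r.ρ (wordHolonomy U x (plaqWord μ ν₀ true).reverse)).trace) +
      (r.ρ (wordHolonomy U x (plaqWord μ ν₀ true).reverse)).trace *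
        -((r.N : ℂ) - s / r.N * ((r.ρ (wordHolonomy U x (plaqWord μ ν₀ true))).trace *
          (r.ρ (wordHolonomy U x (plaqWord μ ν₀ true).reverse)).trace)) +
      (r.ρ (wordHolonomy U x (plaqWord μ ν₀ true).reverse)).trace *
        -((r.N : ℂ) - s / r.N * ((r.ρ (wordHolonomy U x (plaqWord μ ν₀ true))).trace *
          (r.ρ (wordHolonomy U x (plaqWord μ ν₀ true).reverse)).trace)) =
      ((r.N : ℂ) + s / r.N) * ((r.ρ (wordHolonomy U x (plaqWord μ ν₀ true))).trace *
        (r.ρ (wordHolonomy U x (plaqWord μ ν₀ true).reverse)).trace * (r.ρ (wordHolonomy U x (plaqWord μ ν₀ true).reverse)).trace) -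
      2 * (r.N : ℂ) * (r.ρ (wordHolonomy U x (plaqWord μ ν₀ true).reverse)).trace := fun U => by ring
  have hiA : Integrable (fun U : GaugeConfig d L G => ((r.N : ℂ) - s / r.N) * (r.ρ (wordHolonomy U x (plaqWord μ ν₀ true))).trace *
      ((r.ρ (wordHolonomy U x (plaqWord μ ν₀ true).reverse)).trace * (r.ρ (wordHolonomy U x (plaqWord μ ν₀ true).reverse)).trace))
      (wilsonMeasure (d := d) (L := L) r.ρ β) := integrable_of_continuous r β ((continuous_const.mul (hc _)).mul ((hc _).mul (hc _)))
  have hiB : Integrable (fun U : GaugeConfig d L G => (r.ρ (wordHolonomy U x (plaqWord μ ν₀ true).reverse)).trace *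
        -((r.N : ℂ) - s / r.N * ((r.ρ (wordHolonomy U x (plaqWord μ ν₀ true))).trace *
          (r.ρ (wordHolonomy U x (plaqWord μ ν₀ true).reverse)).trace)))
      (wilsonMeasure (d := d) (L := L) r.ρ β) :=
    integrable_of_continuous r β ((hc _).mul (continuous_const.sub (continuous_const.mul ((hc _).mul (hc _)))).neg)
  have hsplit : ∫ U, (((r.N : ℂ) - s / r.N) * (r.ρ (wordHolonomy U x (plaqWord μ ν₀ true))).trace *
      ((r.ρ (wordHolonomy U x (plaqWord μ ν₀ true).reverse)).trace * (r.ρ (wordHolonomy U x (plaqWord μ ν₀ true).reverse)).trace) +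
      (r.ρ (wordHolonomy U x (plaqWord μ ν₀ true).reverse)).trace *
        -((r.N : ℂ) - s / r.N * ((r.ρ (wordHolonomy U x (plaqWord μ ν₀ true))).trace *
          (r.ρ (wordHolonomy U x (plaqWord μ ν₀ true).reverse)).trace)) +
      (r.ρ (wordHolonomy U x (plaqWord μ ν₀ true).reverse)).trace *
        -((r.N : ℂ) - s / r.N * ((r.ρ (wordHolonomy U x (plaqWord μ ν₀ true))).trace *
          (r.ρ (wordHolonomy U x (plaqWord μ ν₀ true).reverse)).trace))) ∂(wilsonMeasure (d := d) (L := L) r.ρ β) =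
      ((r.N : ℂ) + s / r.N) * (∫ U, (r.ρ (wordHolonomy U x (plaqWord μ ν₀ true))).trace *
        (r.ρ (wordHolonomy U x (plaqWord μ ν₀ true).reverse)).trace * (r.ρ (wordHolonomy U x (plaqWord μ ν₀ true).reverse)).trace
          ∂(wilsonMeasure (d := d) (L := L) r.ρ β)) -
      2 * r.N * (∫ U, (r.ρ (wordHolonomy U x (plaqWord μ ν₀ true).reverse)).trace ∂(wilsonMeasure (d := d) (L := L) r.ρ β)) := by
    simp_rw [e1]
    rw [integral_sub (hiK.const_mul _) (hiT.const_mul _), integral_const_mul, integral_const_mul]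
  have hiAB : Integrable (fun U : GaugeConfig d L G => ((r.N : ℂ) - s / r.N) * (r.ρ (wordHolonomy U x (plaqWord μ ν₀ true))).trace *
      ((r.ρ (wordHolonomy U x (plaqWord μ ν₀ true).reverse)).trace * (r.ρ (wordHolonomy U x (plaqWord μ ν₀ true).reverse)).trace) +
      (r.ρ (wordHolonomy U x (plaqWord μ ν₀ true).reverse)).trace *
        -((r.N : ℂ) - s / r.N * ((r.ρ (wordHolonomy U x (plaqWord μ ν₀ true))).trace *
          (r.ρ (wordHolonomy U x (plaqWord μ ν₀ true).reverse)).trace)))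
      (wilsonMeasure (d := d) (L := L) r.ρ β) := hiA.add hiB
  rw [← integral_add hiA hiB, ← integral_add hiAB hiB, hsplit] at h
  linear_combination h

end Integrated

end StrongCoupling

end Summit.QuantumFields.GaugeBoot

end
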